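import Mathlib.Analysis.Calculus.MeanValue
import Mathlib.Analysis.SpecialFunctions.Integrals.Basic
import Mathlib.Analysis.SpecialFunctions.Log.Deriv
import HarnessLib

/-!
# Node weights of `ζ`-mollified combs, I: the midpoint rule and the calculus of one tooth sum

Topic `Literature/NumberTheory/LFunctions`.  Elementary real-variable tools for evaluating the
node weights `K(log n)` of the autocorrelation `K = g ⋆ g̃` of a `ζ`-mollified resonator comb
(`Literature/NumberTheory/LFunctions/WeilCombZeroSide.lean`), organised BY NODE: the inner sum over
one progression of the mollifier, `∑_k k^{-1/2} B((c - log k)/h)` (`B` the autocorrelation of the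
bump, `h` the window), is compared with its integral by the midpoint rule.

* `abs_sub_integral_cell_le` — midpoint rule on one unit cell: `|f(k) - ∫_{k-1/2}^{k+1/2} f| ≤ D/4`
  when `|f''| ≤ D` on the cell;
* `abs_sum_sub_integral_le` — summed over `m` consecutive cells: error `≤ m D / 4`;
* `hasDerivAt_toothProfile`, `hasDerivAt_toothProfile_deriv` — the derivatives of
  `F(t) = e^{-t/2} B((c - t)/h)`, and `abs_toothProfile_deriv_le`, `abs_toothProfile_deriv2_le` —
  `|F'|, |F''| ≤ e^{-t/2} (N₀ + 2 N₁/h + N₂/h²)` from `|B| ≤ N₀`, `|B'| ≤ N₁`, `|B''| ≤ N₂`;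
* `hasDerivAt_comp_log`, `hasDerivAt_comp_log_deriv`, `abs_comp_log_deriv2_le` — the summand
  `f(u) = F(log u)` has `f'' = (F'' - F')(log u)/u²`, `|f''(u)| ≤ 2 e^{-(log u)/2} (…)/u²` on `u > 0`.

Everything is proved; no named facts.  (The comb evaluation these serve is folklore bookkeeping
behind Selberg/Levinson mollifiers and Soundararajan's resonance method.)
-/

noncomputable section

open MeasureTheory Set intervalIntegral

namespace Literature.NumberTheory.LFunctions

/-! ## The midpoint rule -/

/-- **Midpoint rule on one unit cell.** If `f` is twice differentiable on `[k - 1/2, k + 1/2]`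
with `|f''| ≤ D` there, then `|f(k) - ∫_{k-1/2}^{k+1/2} f| ≤ D/4` (Taylor expansion at the
midpoint: the linear term integrates to zero and the remainder is `≤ D (x-k)²`). [folklore] -/
theorem abs_sub_integral_cell_le {f f' f'' : ℝ → ℝ} {D k : ℝ}
    (hf : ∀ x ∈ Icc (k - 1 / 2) (k + 1 / 2), HasDerivAt f (f' x) x)
    (hf' : ∀ x ∈ Icc (k - 1 / 2) (k + 1 / 2), HasDerivAt f' (f'' x) x)
    (hD : ∀ x ∈ Icc (k - 1 / 2) (k + 1 / 2), |f'' x| ≤ D) :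
    |f k - ∫ x in (k - 1 / 2)..(k + 1 / 2), f x| ≤ D / 4 := by
  set I : Set ℝ := Icc (k - 1 / 2) (k + 1 / 2) with hI
  have hkI : k ∈ I := ⟨by linarith, by linarith⟩
  have hD0 : 0 ≤ D := (abs_nonneg _).trans (hD k hkI)
  -- the Taylor remainder at the midpoint
  set φ : ℝ → ℝ := fun x ↦ f x - f k - f' k * (x - k) with hφ
  have hφd : ∀ x ∈ I, HasDerivAt φ (f' x - f' k) x := by
    intro x hx
    have h1 : HasDerivAt (fun x ↦ f' k * (x - k)) (f' k * 1) x :=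
      ((hasDerivAt_id x).sub_const k).const_mul (f' k)
    have h2 : HasDerivAt (fun x ↦ f x - f k - f' k * (x - k)) (f' x - f' k * 1) x :=
      ((hf x hx).sub_const (f k)).sub h1
    simpa [hφ] using h2
  -- `|f'(y) - f'(k)| ≤ D |y - k|` on the cell
  have hlip : ∀ y ∈ I, |f' y - f' k| ≤ D * |y - k| := by
    intro y hy
    have h := Convex.norm_image_sub_le_of_norm_hasDerivWithin_le (f := f') (f' := f'') (s := I)
      (fun x hx ↦ (hf' x hx).hasDerivWithinAt) (fun x hx ↦ by simpa using hD x hx)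
      (convex_Icc _ _) hkI hy
    simpa [Real.norm_eq_abs] using h
  -- `|φ(x)| ≤ D (x - k)²` on the cell
  have hrem : ∀ x ∈ I, |φ x| ≤ D * (x - k) ^ 2 := by
    intro x hx
    have hsub : uIcc k x ⊆ I := by
      rcases le_total k x with hkx | hkx
      · rw [uIcc_of_le hkx]; exact Icc_subset_Icc (by linarith [hkI.1]) hx.2
      · rw [uIcc_of_ge hkx]; exact Icc_subset_Icc hx.1 (by linarith [hkI.2])
    have h := Convex.norm_image_sub_le_of_norm_hasDerivWithin_le (f := φ)
      (f' := fun y ↦ f' y - f' k) (s := uIcc k x) (C := D * |x - k|)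
      (fun y hy ↦ (hφd y (hsub hy)).hasDerivWithinAt)
      (fun y hy ↦ by
        have h1 := hlip y (hsub hy)
        have h2 : |y - k| ≤ |x - k| := abs_sub_left_of_mem_uIcc hy
        have : D * |y - k| ≤ D * |x - k| := mul_le_mul_of_nonneg_left h2 hD0
        simpa [Real.norm_eq_abs] using h1.trans this)
      (convex_uIcc k x) left_mem_uIcc right_mem_uIcc
    have hφk : φ k = 0 := by simp [hφ]
    rw [hφk, sub_zero, Real.norm_eq_abs, Real.norm_eq_abs] at h
    calc |φ x| ≤ D * |x - k| * |x - k| := h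
      _ = D * (x - k) ^ 2 := by rw [mul_assoc, ← sq, sq_abs]
  -- integrability
  have hfc : ContinuousOn f I := fun x hx ↦ (hf x hx).continuousAt.continuousWithinAt
  have hle : k - 1 / 2 ≤ k + 1 / 2 := by linarith
  have hfi : IntervalIntegrable f volume (k - 1 / 2) (k + 1 / 2) :=
    (hfc.mono (by rw [uIcc_of_le hle])).intervalIntegrable
  have hlin : IntervalIntegrable (fun x ↦ f' k * (x - k)) volume (k - 1 / 2) (k + 1 / 2) :=
    ((continuous_const.mul (continuous_id.sub continuous_const)).continuousOn).intervalIntegrable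
  -- the integral of `φ`
  have hφint : ∫ x in (k - 1 / 2)..(k + 1 / 2), φ x
      = (∫ x in (k - 1 / 2)..(k + 1 / 2), f x) - f k := by
    have e1 : (fun x ↦ φ x) = fun x ↦ (f x - f k) - f' k * (x - k) := by funext x; rfl
    rw [e1, intervalIntegral.integral_sub (hfi.sub intervalIntegrable_const) hlin,
      intervalIntegral.integral_sub hfi intervalIntegrable_const, intervalIntegral.integral_const,
      intervalIntegral.integral_const_mul,
      intervalIntegral.integral_sub intervalIntegrable_id intervalIntegrable_const, integral_id,
      intervalIntegral.integral_const]
    simp only [smul_eq_mul]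
    ring
  -- bound the integral of `φ`
  have hbound : ‖∫ x in (k - 1 / 2)..(k + 1 / 2), φ x‖ ≤ D / 4 * |k + 1 / 2 - (k - 1 / 2)| := by
    refine intervalIntegral.norm_integral_le_of_norm_le_const fun x hx ↦ ?_
    rw [uIoc_of_le hle] at hx
    have hxI : x ∈ I := ⟨hx.1.le, hx.2⟩
    have hsq : (x - k) ^ 2 ≤ 1 / 4 := by
      have h1 : |x - k| ≤ 1 / 2 := abs_le.2 ⟨by linarith [hx.1], by linarith [hx.2]⟩
      have h2 : (x - k) ^ 2 = |x - k| ^ 2 := (sq_abs _).symm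
      rw [h2]; nlinarith [abs_nonneg (x - k)]
    rw [Real.norm_eq_abs]
    calc |φ x| ≤ D * (x - k) ^ 2 := hrem x hxI
      _ ≤ D * (1 / 4) := mul_le_mul_of_nonneg_left hsq hD0
      _ = D / 4 := by ring
  have habs : |k + 1 / 2 - (k - 1 / 2)| = 1 := by
    rw [show k + 1 / 2 - (k - 1 / 2) = (1 : ℝ) by ring, abs_one]
  rw [habs, mul_one, Real.norm_eq_abs, hφint, abs_sub_comm] at hbound
  exact hbound

/-- **Midpoint rule on `m` consecutive unit cells**: if `f` is twice differentiable with
`|f''| ≤ D` on `[a - 1/2, a - 1/2 + m]`, then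
`|∑_{j < m} f(a + j) - ∫_{a-1/2}^{a-1/2+m} f| ≤ m D / 4`. [folklore] -/
theorem abs_sum_sub_integral_le {f f' f'' : ℝ → ℝ} {D a : ℝ} (m : ℕ)
    (hf : ∀ x ∈ Icc (a - 1 / 2) (a - 1 / 2 + m), HasDerivAt f (f' x) x)
    (hf' : ∀ x ∈ Icc (a - 1 / 2) (a - 1 / 2 + m), HasDerivAt f' (f'' x) x)
    (hD : ∀ x ∈ Icc (a - 1 / 2) (a - 1 / 2 + m), |f'' x| ≤ D) :
    |∑ j ∈ Finset.range m, f (a + j) - ∫ x in (a - 1 / 2)..(a - 1 / 2 + m), f x|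
      ≤ m * (D / 4) := by
  induction m with
  | zero => simp
  | succ m ih =>
    have hsub : Icc (a - 1 / 2) (a - 1 / 2 + (m : ℕ)) ⊆ Icc (a - 1 / 2) (a - 1 / 2 + ((m + 1 : ℕ) : ℝ)) :=
      Icc_subset_Icc le_rfl (by push_cast; linarith)
    have hcell : Icc (a + m - 1 / 2) (a + m + 1 / 2) ⊆ Icc (a - 1 / 2) (a - 1 / 2 + ((m + 1 : ℕ) : ℝ)) :=
      Icc_subset_Icc (by linarith [(m.cast_nonneg : (0 : ℝ) ≤ m)]) (by push_cast; linarith)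
    have ih' := ih (fun x hx ↦ hf x (hsub hx)) (fun x hx ↦ hf' x (hsub hx)) (fun x hx ↦ hD x (hsub hx))
    have hc := abs_sub_integral_cell_le (k := a + m) (fun x hx ↦ hf x (hcell hx))
      (fun x hx ↦ hf' x (hcell hx)) (fun x hx ↦ hD x (hcell hx))
    -- continuity, for splitting the integral
    have hfc : ContinuousOn f (Icc (a - 1 / 2) (a - 1 / 2 + ((m + 1 : ℕ) : ℝ))) :=
      fun x hx ↦ (hf x hx).continuousAt.continuousWithinAt
    have h1 : IntervalIntegrable f volume (a - 1 / 2) (a - 1 / 2 + m) := by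
      refine (hfc.mono ?_).intervalIntegrable
      rw [uIcc_of_le (by linarith [(m.cast_nonneg : (0 : ℝ) ≤ m)])]
      exact hsub
    have h2 : IntervalIntegrable f volume (a - 1 / 2 + m) (a - 1 / 2 + ((m + 1 : ℕ) : ℝ)) := by
      refine (hfc.mono ?_).intervalIntegrable
      rw [uIcc_of_le (by push_cast; linarith)]
      exact Icc_subset_Icc (by linarith [(m.cast_nonneg : (0 : ℝ) ≤ m)]) le_rfl
    rw [Finset.sum_range_succ, ← intervalIntegral.integral_add_adjacent_intervals h1 h2]
    have e1 : a + m - 1 / 2 = a - 1 / 2 + (m : ℝ) := by ring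
    have e2 : a + m + 1 / 2 = a - 1 / 2 + ((m + 1 : ℕ) : ℝ) := by push_cast; ring
    rw [e1, e2] at hc
    calc |∑ j ∈ Finset.range m, f (a + j) + f (a + m) -
          ((∫ x in (a - 1 / 2)..(a - 1 / 2 + (m : ℝ)), f x) +
            ∫ x in (a - 1 / 2 + (m : ℝ))..(a - 1 / 2 + ((m + 1 : ℕ) : ℝ)), f x)|
        = |(∑ j ∈ Finset.range m, f (a + j) - ∫ x in (a - 1 / 2)..(a - 1 / 2 + (m : ℝ)), f x) +
            (f (a + m) - ∫ x in (a - 1 / 2 + (m : ℝ))..(a - 1 / 2 + ((m + 1 : ℕ) : ℝ)), f x)| := by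
          ring_nf
      _ ≤ |∑ j ∈ Finset.range m, f (a + j) - ∫ x in (a - 1 / 2)..(a - 1 / 2 + (m : ℝ)), f x| +
            |f (a + m) - ∫ x in (a - 1 / 2 + (m : ℝ))..(a - 1 / 2 + ((m + 1 : ℕ) : ℝ)), f x| :=
          abs_add_le _ _
      _ ≤ m * (D / 4) + D / 4 := add_le_add ih' hc
      _ = ((m + 1 : ℕ) : ℝ) * (D / 4) := by push_cast; ring

/-! ## The profile `F(t) = e^{-t/2} B((c - t)/h)` of one tooth sum and its derivatives -/

/-- First derivative of `F(t) = e^{-t/2} B((c-t)/h)`: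
`F'(t) = e^{-t/2} (-B((c-t)/h)/2 - B'((c-t)/h)/h)`. [folklore] -/
theorem hasDerivAt_toothProfile {B B' : ℝ → ℝ} (hB : ∀ x, HasDerivAt B (B' x) x) (c h t : ℝ) :
    HasDerivAt (fun t ↦ Real.exp (-t / 2) * B ((c - t) / h))
      (Real.exp (-t / 2) * (-(B ((c - t) / h)) / 2 - B' ((c - t) / h) / h)) t := by
  have h1 : HasDerivAt (fun t ↦ Real.exp (-t / 2)) (Real.exp (-t / 2) * (-1 / 2)) t := by
    have := ((hasDerivAt_id t).neg.div_const 2).exp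
    simpa using this
  have h2 : HasDerivAt (fun t ↦ (c - t) / h) (-1 / h) t := by
    simpa using ((hasDerivAt_id t).const_sub c).div_const h
  have h3 : HasDerivAt (fun t ↦ B ((c - t) / h)) (B' ((c - t) / h) * (-1 / h)) t :=
    (hB _).comp t h2
  have h4 : HasDerivAt (fun t ↦ Real.exp (-t / 2) * B ((c - t) / h))
      (Real.exp (-t / 2) * (-1 / 2) * B ((c - t) / h) +
        Real.exp (-t / 2) * (B' ((c - t) / h) * (-1 / h))) t := h1.mul h3
  refine h4.congr_deriv ?_
  field_simp
  ring

/-- Second derivative: with `F'(t) = e^{-t/2}(-B/2 - B'/h)((c-t)/h)`,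
`F''(t) = e^{-t/2} (B/4 + B'/h + B''/h²)((c-t)/h)`. [folklore] -/
theorem hasDerivAt_toothProfile_deriv {B B' B'' : ℝ → ℝ} (hB : ∀ x, HasDerivAt B (B' x) x)
    (hB' : ∀ x, HasDerivAt B' (B'' x) x) (c h t : ℝ) :
    HasDerivAt (fun t ↦ Real.exp (-t / 2) * (-(B ((c - t) / h)) / 2 - B' ((c - t) / h) / h))
      (Real.exp (-t / 2) *
        (B ((c - t) / h) / 4 + B' ((c - t) / h) / h + B'' ((c - t) / h) / h ^ 2)) t := by
  have h1 : HasDerivAt (fun t ↦ Real.exp (-t / 2)) (Real.exp (-t / 2) * (-1 / 2)) t := by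
    have := ((hasDerivAt_id t).neg.div_const 2).exp
    simpa using this
  have h2 : HasDerivAt (fun t ↦ (c - t) / h) (-1 / h) t := by
    simpa using ((hasDerivAt_id t).const_sub c).div_const h
  have h3 : HasDerivAt (fun t ↦ B ((c - t) / h)) (B' ((c - t) / h) * (-1 / h)) t :=
    (hB _).comp t h2
  have h4 : HasDerivAt (fun t ↦ B' ((c - t) / h)) (B'' ((c - t) / h) * (-1 / h)) t :=
    (hB' _).comp t h2
  have h5 : HasDerivAt (fun t ↦ -(B ((c - t) / h)) / 2 - B' ((c - t) / h) / h)
      (-(B' ((c - t) / h) * (-1 / h)) / 2 - B'' ((c - t) / h) * (-1 / h) / h) t :=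
    (h3.neg.div_const 2).sub (h4.div_const h)
  have h6 : HasDerivAt (fun t ↦ Real.exp (-t / 2) * (-(B ((c - t) / h)) / 2 - B' ((c - t) / h) / h))
      (Real.exp (-t / 2) * (-1 / 2) * (-(B ((c - t) / h)) / 2 - B' ((c - t) / h) / h) +
        Real.exp (-t / 2) * (-(B' ((c - t) / h) * (-1 / h)) / 2 - B'' ((c - t) / h) * (-1 / h) / h)) t :=
    h1.mul h5
  refine h6.congr_deriv ?_
  rcases eq_or_ne h 0 with hh | hh
  · subst hh; simp; ring
  · field_simp
    ring

/-- Bound for `F'`: `|F'(t)| ≤ e^{-t/2} (N₀ + 2N₁/h + N₂/h²)` whenever `|B| ≤ N₀`, `|B'| ≤ N₁`,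
`0 ≤ N₂`, `h > 0`. [folklore] -/
theorem abs_toothProfile_deriv_le {B B' : ℝ → ℝ} {N₀ N₁ N₂ : ℝ} (h0 : ∀ x, |B x| ≤ N₀)
    (h1 : ∀ x, |B' x| ≤ N₁) (hN₂ : 0 ≤ N₂) {h : ℝ} (hh : 0 < h) (c t : ℝ) :
    |Real.exp (-t / 2) * (-(B ((c - t) / h)) / 2 - B' ((c - t) / h) / h)|
      ≤ Real.exp (-t / 2) * (N₀ + 2 * N₁ / h + N₂ / h ^ 2) := by
  have hN₀ : 0 ≤ N₀ := (abs_nonneg _).trans (h0 0)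
  have hN₁ : 0 ≤ N₁ := (abs_nonneg _).trans (h1 0)
  rw [abs_mul, abs_of_pos (Real.exp_pos _)]
  refine mul_le_mul_of_nonneg_left ?_ (Real.exp_pos _).le
  have ha := h0 ((c - t) / h)
  have hb := h1 ((c - t) / h)
  calc |-(B ((c - t) / h)) / 2 - B' ((c - t) / h) / h|
      ≤ |-(B ((c - t) / h)) / 2| + |B' ((c - t) / h) / h| := abs_sub _ _
    _ = |B ((c - t) / h)| / 2 + |B' ((c - t) / h)| / h := by
        rw [abs_div, abs_neg, abs_div, abs_of_pos hh, abs_two]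
    _ ≤ N₀ / 2 + N₁ / h := add_le_add (by linarith) (div_le_div_of_nonneg_right hb hh.le)
    _ ≤ N₀ + 2 * N₁ / h + N₂ / h ^ 2 := by
        have : 0 ≤ N₁ / h := by positivity
        have : 0 ≤ N₂ / h ^ 2 := by positivity
        have : 2 * N₁ / h = 2 * (N₁ / h) := by ring
        linarith

/-- Bound for `F''`: `|F''(t)| ≤ e^{-t/2} (N₀ + 2N₁/h + N₂/h²)` whenever `|B| ≤ N₀`, `|B'| ≤ N₁`,
`|B''| ≤ N₂`, `0 < h`. [folklore] -/
theorem abs_toothProfile_deriv2_le {B B' B'' : ℝ → ℝ} {N₀ N₁ N₂ : ℝ} (h0 : ∀ x, |B x| ≤ N₀)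
    (h1 : ∀ x, |B' x| ≤ N₁) (h2 : ∀ x, |B'' x| ≤ N₂) {h : ℝ} (hh : 0 < h) (c t : ℝ) :
    |Real.exp (-t / 2) *
        (B ((c - t) / h) / 4 + B' ((c - t) / h) / h + B'' ((c - t) / h) / h ^ 2)|
      ≤ Real.exp (-t / 2) * (N₀ + 2 * N₁ / h + N₂ / h ^ 2) := by
  have hN₀ : 0 ≤ N₀ := (abs_nonneg _).trans (h0 0)
  have hN₁ : 0 ≤ N₁ := (abs_nonneg _).trans (h1 0)
  rw [abs_mul, abs_of_pos (Real.exp_pos _)]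
  refine mul_le_mul_of_nonneg_left ?_ (Real.exp_pos _).le
  have ha := h0 ((c - t) / h)
  have hb := h1 ((c - t) / h)
  have hc := h2 ((c - t) / h)
  have hh2 : 0 < h ^ 2 := by positivity
  calc |B ((c - t) / h) / 4 + B' ((c - t) / h) / h + B'' ((c - t) / h) / h ^ 2|
      ≤ |B ((c - t) / h) / 4 + B' ((c - t) / h) / h| + |B'' ((c - t) / h) / h ^ 2| := abs_add_le _ _
    _ ≤ |B ((c - t) / h) / 4| + |B' ((c - t) / h) / h| + |B'' ((c - t) / h) / h ^ 2| :=
        add_le_add (abs_add_le _ _) le_rfl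
    _ = |B ((c - t) / h)| / 4 + |B' ((c - t) / h)| / h + |B'' ((c - t) / h)| / h ^ 2 := by
        rw [abs_div, abs_div, abs_div, abs_of_pos hh, abs_of_pos hh2]
        norm_num
    _ ≤ N₀ / 4 + N₁ / h + N₂ / h ^ 2 :=
        add_le_add (add_le_add (by linarith) (div_le_div_of_nonneg_right hb hh.le))
          (div_le_div_of_nonneg_right hc hh2.le)
    _ ≤ N₀ + 2 * N₁ / h + N₂ / h ^ 2 := by
        have : 0 ≤ N₁ / h := by positivity
        have : 2 * N₁ / h = 2 * (N₁ / h) := by ring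
        linarith

/-! ## The summand `f(u) = F(log u)` on `u > 0` -/

/-- Chain rule through `log`: if `F` has derivative `F'(log u)` at `log u` then `u ↦ F(log u)` has
derivative `F'(log u) u⁻¹` at `u > 0`. [folklore] -/
theorem hasDerivAt_comp_log {F : ℝ → ℝ} {F't u : ℝ} (hu : 0 < u)
    (hF : HasDerivAt F F't (Real.log u)) :
    HasDerivAt (fun u ↦ F (Real.log u)) (F't * u⁻¹) u :=
  hF.comp u (Real.hasDerivAt_log hu.ne')

/-- Second derivative through `log`: if `F'` has derivative `F''(log u)` at `log u` then
`u ↦ F'(log u) u⁻¹` has derivative `(F''(log u) - F'(log u)) / u²` at `u > 0`. [folklore] -/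
theorem hasDerivAt_comp_log_deriv {F' : ℝ → ℝ} {F''t u : ℝ} (hu : 0 < u)
    (hF' : HasDerivAt F' F''t (Real.log u)) :
    HasDerivAt (fun u ↦ F' (Real.log u) * u⁻¹) ((F''t - F' (Real.log u)) / u ^ 2) u := by
  have h1 : HasDerivAt (fun u ↦ F' (Real.log u)) (F''t * u⁻¹) u := hasDerivAt_comp_log hu hF'
  have h2 : HasDerivAt (fun u : ℝ ↦ u⁻¹) (-(u ^ 2)⁻¹) u := hasDerivAt_inv hu.ne'
  have h3 : HasDerivAt (fun u ↦ F' (Real.log u) * u⁻¹)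
      (F''t * u⁻¹ * u⁻¹ + F' (Real.log u) * -(u ^ 2)⁻¹) u := h1.mul h2
  refine h3.congr_deriv ?_
  field_simp
  ring

/-- The size of `f''`: if `|F'(log u)|, |F''(log u)| ≤ e^{-(log u)/2} N` then
`|(F''(log u) - F'(log u))/u²| ≤ 2 N e^{-(log u)/2} / u²`. [folklore] -/
theorem abs_comp_log_deriv2_le {a b N u : ℝ} (hu : 0 < u)
    (ha : |a| ≤ Real.exp (-Real.log u / 2) * N) (hb : |b| ≤ Real.exp (-Real.log u / 2) * N) :
    |(b - a) / u ^ 2| ≤ 2 * N * Real.exp (-Real.log u / 2) / u ^ 2 := by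
  have hu2 : 0 < u ^ 2 := by positivity
  rw [abs_div, abs_of_pos hu2]
  refine div_le_div_of_nonneg_right ?_ hu2.le
  calc |b - a| ≤ |b| + |a| := abs_sub _ _
    _ ≤ Real.exp (-Real.log u / 2) * N + Real.exp (-Real.log u / 2) * N := add_le_add hb ha
    _ = 2 * N * Real.exp (-Real.log u / 2) := by ring

/-- `e^{-(log u)/2} = 1/√u` for `u > 0`. [folklore] -/
theorem exp_neg_log_half {u : ℝ} (hu : 0 < u) : Real.exp (-Real.log u / 2) = (Real.sqrt u)⁻¹ := by
  rw [show -Real.log u / 2 = -(Real.log u / 2) by ring, Real.exp_neg, ← Real.log_sqrt hu.le,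
    Real.exp_log (Real.sqrt_pos.2 hu)]

/-- Monotonicity of the size function: for `0 < A ≤ u`,
`e^{-(log u)/2}/u² ≤ e^{-(log A)/2}/A²`. [folklore] -/
theorem exp_neg_log_half_div_sq_le {A u : ℝ} (hA : 0 < A) (hAu : A ≤ u) :
    Real.exp (-Real.log u / 2) / u ^ 2 ≤ Real.exp (-Real.log A / 2) / A ^ 2 := by
  have hu : 0 < u := hA.trans_le hAu
  have h1 : Real.exp (-Real.log u / 2) ≤ Real.exp (-Real.log A / 2) := by
    apply Real.exp_le_exp.2
    have := Real.log_le_log hA hAu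
    linarith
  have h2 : A ^ 2 ≤ u ^ 2 := pow_le_pow_left₀ hA.le hAu 2
  have hA2 : 0 < A ^ 2 := by positivity
  calc Real.exp (-Real.log u / 2) / u ^ 2 ≤ Real.exp (-Real.log A / 2) / u ^ 2 :=
        div_le_div_of_nonneg_right h1 (by positivity)
    _ ≤ Real.exp (-Real.log A / 2) / A ^ 2 :=
        div_le_div_of_nonneg_left (Real.exp_pos _).le hA2 h2

end Literature.NumberTheory.LFunctions
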